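import Mathlib
import HarnessLib
import Summits.AtomisticToContinuum.Crystallization.Theorems.PricedLinkCensusSoftLayerPropagationOneStackingMapSearchDefs
import Summits.AtomisticToContinuum.Crystallization.Theorems.PricedLinkCensusSoftLayerPropagationOneStackingMapSearchBasic
import Summits.AtomisticToContinuum.Crystallization.Theorems.PricedLinkCensusSoftLayerPropagationOneStackingMapCompletions
import Summits.AtomisticToContinuum.Crystallization.Theorems.PricedLinkCensusSoftLayerPropagationOneStackingMapRealizes
import Summits.AtomisticToContinuum.Crystallization.Theorems.PricedLinkCensusSoftLayerPropagationOneStackingMapLink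

/-!
# One-stacking map engine: soundness of closing a star and of the expansion step

Route `PricedLinkCensus`, crux `SoftLayerPropagation` (stmt-AtomisticToContinuum-14233), line
`Sketch`, stub `stub_oneStackingMap`.  **`finish_sound`**: once every slot of the cursor site is
recorded, `St.finish` succeeds on a realized state and the result (bonds among the twelve
neighbours recorded, cursor advanced) is realized — two neighbours at unit shadow distance ARE
bonded, an expanded or saturated one would have recorded it, and bonded ones ARE at unit distance.
**`options_sound`** (the expansion step): for a realized state whose cursor site has level `≤ 4`,
some member of `St.options TABLE s` is realized — the true star is a candidate (the model itself at
the centre, `completions_sound` elsewhere), `linkSlots_sound`, `finish_sound`.  All [folklore].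
-/

noncomputable section

namespace Summit.AtomisticToContinuum.Crystallization.Theorems

namespace OneStacking

open V3

/-! ### The star-closing fold -/

namespace St

/-- One step of the fold in `St.finish`. [folklore] -/
def finStep (acc : Option St) (kk : ℕ × ℕ) : Option St :=
  match acc with
  | none => none
  | some s =>
    let k := kk.1; let k2 := kk.2
    let unit : Bool := decide (V3.n2 (V3.sub (s.pos k) (s.pos k2)) = NN2)
    let adj : Bool := (s.nbrs k).contains k2
    if unit && !adj then
      (if k < s.cur ∨ k2 < s.cur ∨ 12 ≤ (s.nbrs k).length ∨ 12 ≤ (s.nbrs k2).length then none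
       else some (s.link k k2))
    else if adj && !unit then none else some s

/-- `St.finish` through `finStep`. [folklore] -/
theorem finish_eq (j : ℕ) (s : St) : finish j s =
    if (s.nbrs j).length ≠ 12 then none
    else (((pairs (s.nbrs j)).foldl finStep (some s)).map fun t => { t with cur := t.cur + 1 }) := rfl

/-- `finStep` on a contradiction. [folklore] -/
@[simp] theorem finStep_none (kk : ℕ × ℕ) : finStep none kk = none := rfl

/-- A fold from a contradiction stays a contradiction. [folklore] -/
theorem foldl_finStep_none (l : List (ℕ × ℕ)) : l.foldl finStep none = none := by
  induction l with
  | nil => rfl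
  | cons a l ih => rw [List.foldl_cons, finStep_none, ih]

/-- `finStep` links two unbonded neighbours at unit distance. [folklore] -/
theorem finStep_link {t : St} {k k2 : ℕ} (hu : V3.n2 (V3.sub (t.pos k) (t.pos k2)) = NN2) (ha : k2 ∉ t.nbrs k)
    (hc : ¬ (k < t.cur ∨ k2 < t.cur ∨ 12 ≤ (t.nbrs k).length ∨ 12 ≤ (t.nbrs k2).length)) :
    finStep (some t) (k, k2) = some (t.link k k2) := by
  have ha' : (t.nbrs k).contains k2 = false := by simpa [List.contains_iff_mem] using ha
  simp only [finStep, hu, decide_true, ha', Bool.not_false, Bool.and_self, if_true, if_neg hc]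

/-- `finStep` keeps the state on a recorded unit pair. [folklore] -/
theorem finStep_keep_adj {t : St} {k k2 : ℕ} (hu : V3.n2 (V3.sub (t.pos k) (t.pos k2)) = NN2) (ha : k2 ∈ t.nbrs k) :
    finStep (some t) (k, k2) = some t := by
  simp [finStep, hu, ha]

/-- `finStep` keeps the state on an unrecorded non-unit pair. [folklore] -/
theorem finStep_keep_far {t : St} {k k2 : ℕ} (hu : V3.n2 (V3.sub (t.pos k) (t.pos k2)) ≠ NN2) (ha : k2 ∉ t.nbrs k) :
    finStep (some t) (k, k2) = some t := by
  simp [finStep, hu, ha]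

/-- Members of `pairs l` are pairs of members at different positions. [folklore] -/
theorem mem_pairs {l : List ℕ} (hl : l.Nodup) {k k2 : ℕ} (h : (k, k2) ∈ pairs l) : k ∈ l ∧ k2 ∈ l ∧ k ≠ k2 := by
  induction l with
  | nil => simp [pairs] at h
  | cons a l ih =>
    rw [List.nodup_cons] at hl
    simp only [pairs, List.mem_append, List.mem_map, Prod.mk.injEq] at h
    rcases h with ⟨b, hb, rfl, rfl⟩ | h
    · exact ⟨List.mem_cons_self, List.mem_cons_of_mem _ hb, fun h => hl.1 (h ▸ hb)⟩
    · obtain ⟨h1, h2, h3⟩ := ih hl.2 h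
      exact ⟨List.mem_cons_of_mem _ h1, List.mem_cons_of_mem _ h2, h3⟩

/-- Accessors of a cursor update. [folklore] -/
@[simp] theorem size_cur_update (t : St) (c : ℕ) : ({ t with cur := c } : St).size = t.size := rfl
/-- Accessors of a cursor update. [folklore] -/
@[simp] theorem pos_cur_update (t : St) (c a : ℕ) : ({ t with cur := c } : St).pos a = t.pos a := rfl
/-- Accessors of a cursor update. [folklore] -/
@[simp] theorem lvl_cur_update (t : St) (c a : ℕ) : ({ t with cur := c } : St).lvl a = t.lvl a := rfl
/-- Accessors of a cursor update. [folklore] -/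
@[simp] theorem nbrs_cur_update (t : St) (c a : ℕ) : ({ t with cur := c } : St).nbrs a = t.nbrs a := rfl

end St

section Finish

variable {A : Dev}

/-- Unit shadow distance between two represented sites = a bond, among the neighbours of a
`4`-ball site. [folklore] -/
theorem unit_iff_adj {s : St} {emb : ℕ → Fin A.N} (hR : RealizedBy A s emb) {x : Fin A.N}
    (hx : ∃ w : A.G.Walk A.i x, w.length ≤ 4) {k k2 : ℕ} (hk : k < s.size) (hk2 : k2 < s.size)
    (hxk : A.G.Adj x (emb k)) (hxk2 : A.G.Adj x (emb k2)) :
    V3.n2 (V3.sub (s.pos k) (s.pos k2)) = NN2 ↔ A.G.Adj (emb k) (emb k2) := by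
  rw [A.adj_iff x hx (emb k) (emb k2) hxk hxk2, hR.posE k hk, hR.posE k2 hk2, ← toE3_sub, norm_toE3_sq_eq_two_iff]

/-- **The star-closing fold succeeds and stays realized.** [folklore] -/
theorem foldl_finStep_sound {emb : ℕ → Fin A.N} {x : Fin A.N} (hx : ∃ w : A.G.Walk A.i x, w.length ≤ 4) :
    ∀ (prs : List (ℕ × ℕ)) (t : St), RealizedBy A t emb →
      (∀ kk ∈ prs, kk.1 < t.size ∧ kk.2 < t.size ∧ kk.1 ≠ kk.2 ∧ A.G.Adj x (emb kk.1) ∧ A.G.Adj x (emb kk.2)) →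
      ∃ t', prs.foldl St.finStep (some t) = some t' ∧ Nonempty (RealizedBy A t' emb) ∧ t'.cur = t.cur ∧
        t'.size = t.size ∧ (∀ a, t'.pos a = t.pos a) ∧ (∀ a, t'.lvl a = t.lvl a) ∧
        (∀ a b, b ∈ t.nbrs a → b ∈ t'.nbrs a) := by
  intro prs
  induction prs with
  | nil => intro t hR _; exact ⟨t, rfl, ⟨hR⟩, rfl, rfl, fun _ => rfl, fun _ => rfl, fun _ _ h => h⟩
  | cons kk prs ih =>
    intro t hR hprs
    obtain ⟨k, k2⟩ := kk
    obtain ⟨hk, hk2, hne, hxk, hxk2⟩ := hprs (k, k2) List.mem_cons_self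
    simp only at hk hk2 hne hxk hxk2
    have hprs' : ∀ kk ∈ prs, kk.1 < t.size ∧ kk.2 < t.size ∧ kk.1 ≠ kk.2 ∧ A.G.Adj x (emb kk.1) ∧ A.G.Adj x (emb kk.2) :=
      fun kk hkk => hprs kk (List.mem_cons_of_mem _ hkk)
    rw [List.foldl_cons]
    by_cases hu : V3.n2 (V3.sub (t.pos k) (t.pos k2)) = NN2
    · have hadj : A.G.Adj (emb k) (emb k2) := (unit_iff_adj hR hx hk hk2 hxk hxk2).1 hu
      by_cases ha : k2 ∈ t.nbrs k
      · rw [St.finStep_keep_adj hu ha]; exact ih t hR hprs'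
      · -- an expanded or saturated endpoint would have recorded the bond
        have hka : k ∉ t.nbrs k2 := fun h => ha (hR.symm k2 hk2 k h)
        have hc : ¬ (k < t.cur ∨ k2 < t.cur ∨ 12 ≤ (t.nbrs k).length ∨ 12 ≤ (t.nbrs k2).length) := by
          rintro (h | h | h | h)
          · obtain ⟨b, hb, hbe⟩ := hR.doneE k h (emb k2) hadj
            rw [hR.inj b k2 (hR.adj hb).2.1 hk2 hbe] at hb; exact ha hb
          · obtain ⟨b, hb, hbe⟩ := hR.doneE k2 h (emb k) hadj.symm
            rw [hR.inj b k (hR.adj hb).2.1 hk hbe] at hb; exact hka hb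
          · obtain ⟨b, hb, hbe⟩ := hR.saturated hk h hadj
            rw [hR.inj b k2 (hR.adj hb).2.1 hk2 hbe] at hb; exact ha hb
          · obtain ⟨b, hb, hbe⟩ := hR.saturated hk2 h hadj.symm
            rw [hR.inj b k (hR.adj hb).2.1 hk hbe] at hb; exact hka hb
        rw [St.finStep_link hu ha hc]
        have hc' : ¬ k < t.cur ∧ ¬ k2 < t.cur := ⟨fun h => hc (Or.inl h), fun h => hc (Or.inr (Or.inl h))⟩
        have hRl : RealizedBy A (t.link k k2) emb := hR.link hk hk2 hadj ha hka (not_lt.1 hc'.1) (not_lt.1 hc'.2)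
        obtain ⟨t', ht', hR', hc1, hs1, hp1, hl1, hn1⟩ := ih (t.link k k2) hRl (by simpa using hprs')
        refine ⟨t', ht', hR', by simpa using hc1, by simpa using hs1, fun a => by rw [hp1, St.pos_link],
          fun a => by rw [hl1, St.lvl_link], fun a b hb => hn1 a b ((St.mem_nbrs_link t hk hk2 a b).2 (Or.inl hb))⟩
    · by_cases ha : k2 ∈ t.nbrs k
      · exact absurd ((unit_iff_adj hR hx hk hk2 hxk hxk2).2 (hR.adj ha).2.2) hu
      · rw [St.finStep_keep_far hu ha]; exact ih t hR hprs'

/-- **Soundness of `St.finish`** (see the file header). [folklore] -/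
theorem finish_sound {s : St} {emb : ℕ → Fin A.N} (hR : RealizedBy A s emb) {j : ℕ} (hj : j = s.cur)
    (hcur : s.cur < s.size) (hl : s.lvl j ≤ 4) {V : List V3}
    (hV1 : ∀ k, A.G.Adj (emb j) k → ∃ v ∈ V, A.pos k = A.pos (emb j) + toE3 v)
    (hcov : ∀ v ∈ V, ∃ b ∈ s.nbrs j, s.pos b = V3.add (s.pos j) v) :
    ∃ s2, St.finish j s = some s2 ∧ Nonempty (RealizedBy A s2 emb) := by
  have hjs : j < s.size := by rw [hj]; exact hcur
  have hx : ∃ w : A.G.Walk A.i (emb j), w.length ≤ 4 := A.ball_mono hl (hR.lvlE j hjs)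
  -- every true neighbour is recorded
  have hrec : ∀ k, A.G.Adj (emb j) k → ∃ b ∈ s.nbrs j, emb b = k := by
    intro k hk
    obtain ⟨v, hv, hkv⟩ := hV1 k hk
    obtain ⟨b, hb, hbp⟩ := hcov v hv
    refine ⟨b, hb, A.star_inj (emb j) hx (emb b) k (hR.adj hb).2.2 hk ?_⟩
    rw [hR.posE b (hR.adj hb).2.1, hbp, toE3_add, ← hR.posE j hjs, hkv]
  -- hence exactly twelve recorded neighbours
  have hlen : (s.nbrs j).length = 12 := by
    refine le_antisymm (hR.length_le hjs) ?_
    obtain ⟨l, hl, hlen12, hiff⟩ := A.twelve (emb j) (A.ball_mono (by omega) hx)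
    have hsub : l ⊆ (s.nbrs j).map emb := fun k hk => by
      obtain ⟨b, hb, rfl⟩ := hrec k ((hiff k).2 hk)
      exact List.mem_map.2 ⟨b, hb, rfl⟩
    have := (List.subperm_of_subset hl hsub).length_le
    rw [List.length_map, hlen12] at this
    exact this
  -- the fold
  have hprs : ∀ kk ∈ St.pairs (s.nbrs j), kk.1 < s.size ∧ kk.2 < s.size ∧ kk.1 ≠ kk.2 ∧
      A.G.Adj (emb j) (emb kk.1) ∧ A.G.Adj (emb j) (emb kk.2) := by
    rintro ⟨k, k2⟩ hkk
    obtain ⟨h1, h2, h3⟩ := St.mem_pairs (hR.nodup j hjs) hkk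
    exact ⟨(hR.adj h1).2.1, (hR.adj h2).2.1, h3, (hR.adj h1).2.2, (hR.adj h2).2.2⟩
  obtain ⟨t', ht', ⟨hR'⟩, hc1, hs1, hp1, hl1, hn1⟩ := foldl_finStep_sound hx _ s hR hprs
  refine ⟨{ t' with cur := t'.cur + 1 }, ?_, ⟨?_⟩⟩
  · rw [St.finish_eq, if_neg (by rw [hlen]; decide), ht']; rfl
  · -- realization with the cursor advanced past `j`
    have hcur' : t'.cur = j := hc1.trans hj.symm
    refine ⟨?_, ?_, hR'.emb_zero, ?_, ?_, ?_, ?_, ?_, ?_, ?_, ?_, ?_⟩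
    · rw [St.size_cur_update]; exact hR'.size_pos
    · show t'.cur + 1 ≤ t'.size; rw [hcur', hs1]; omega
    · intro a b ha hb; exact hR'.inj a b ha hb
    · intro a ha; exact hR'.posE a ha
    · intro a ha; exact hR'.lvlE a ha
    · intro a ha; exact hR'.lvl5 a ha
    · intro a ha
      change a < t'.cur + 1 at ha
      rw [St.lvl_cur_update]
      rcases Nat.lt_succ_iff_lt_or_eq.1 ha with ha | rfl
      · exact hR'.lvl4 a ha
      · rw [hcur', hl1]; exact hl
    · intro a ha b hb; exact hR'.nbrE a ha b hb
    · intro a ha k hk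
      change a < t'.cur + 1 at ha
      rw [St.nbrs_cur_update]
      rcases Nat.lt_succ_iff_lt_or_eq.1 ha with ha | rfl
      · exact hR'.doneE a ha k hk
      · rw [hcur'] at hk ⊢
        obtain ⟨b, hb, hbe⟩ := hrec k hk
        exact ⟨b, hn1 j b hb, hbe⟩
    · intro a ha b hb; exact hR'.symm a ha b hb
    · intro a ha; exact hR'.nodup a ha

end Finish

/-! ### The expansion step -/

section Options

variable {A : Dev}

/-- The two models consist of unit vectors. [folklore] -/
theorem n2_eq_of_mem_model {P0 : List V3} (hP0 : P0 = FCC ∨ P0 = HCP) {p : V3} (hp : p ∈ P0) : V3.n2 p = NN2 := by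
  have hF : ∀ q ∈ FCC, V3.n2 q = NN2 := by decide
  have hH : ∀ q ∈ HCP, V3.n2 q = NN2 := by decide
  rcases hP0 with rfl | rfl
  · exact hF p hp
  · exact hH p hp

/-- Unfolding `St.options`. [folklore] -/
theorem options_eq (tbl : List CEntry) (s : St) : s.options tbl =
    (if s.cur = 0 then some [FCC, HCP] else completions tbl (s.known s.cur)).map fun cs =>
      (cs.filter fun V => (s.known s.cur).all fun w => V.contains w).flatMap fun V =>
        (St.linkSlots s.cur V s).filterMap (St.finish s.cur) := rfl

/-- **The true star of the cursor site is a candidate**, in the state's coordinates: some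
`V` among the admissible patterns realizes both inclusions of the star with unit vectors.
[folklore] -/
theorem exists_candidate {s : St} {emb : ℕ → Fin A.N} (hR : RealizedBy A s emb) (hcur : s.cur < s.size)
    (hl : s.lvl s.cur ≤ 4) {cs : List (List V3)}
    (hcs : (if s.cur = 0 then some [FCC, HCP] else completions TABLE (s.known s.cur)) = some cs) :
    ∃ V ∈ cs.filter (fun V => (s.known s.cur).all fun w => V.contains w),
      (∀ v ∈ V, V3.n2 v = NN2) ∧
      (∀ k, A.G.Adj (emb s.cur) k → ∃ v ∈ V, A.pos k = A.pos (emb s.cur) + toE3 v) ∧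
      (∀ v ∈ V, ∃ k, A.G.Adj (emb s.cur) k ∧ A.pos k = A.pos (emb s.cur) + toE3 v) := by
  set j := s.cur with hj
  -- the recorded partial star, in shadow coordinates
  have hknown : ∀ w ∈ s.known j, ∃ b ∈ s.nbrs j, A.G.Adj (emb j) (emb b) ∧
      toE3 w = A.pos (emb b) - A.pos (emb j) := by
    intro w hw
    obtain ⟨b, hb, rfl⟩ := List.mem_map.1 hw
    exact ⟨b, hb, (hR.adj hb).2.2, by rw [toE3_sub, hR.posE b (hR.adj hb).2.1, hR.posE j hcur]⟩
  by_cases hj0 : j = 0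
  · -- the centre: the model itself
    rw [if_pos hj0] at hcs
    cases hcs
    obtain ⟨P0, hP0, h1, h2⟩ := A.root_star
    have hxi : emb j = A.i := by rw [hj0]; exact hR.emb_zero
    have hpos0 : A.pos (emb j) = 0 := by rw [hxi]; exact A.pos_i
    refine ⟨P0, ?_, fun v hv => n2_eq_of_mem_model hP0 hv, ?_, ?_⟩
    · rw [List.mem_filter]
      refine ⟨by rcases hP0 with rfl | rfl <;> simp, List.all_eq_true.2 fun w hw => ?_⟩
      obtain ⟨b, hb, hadj, hw'⟩ := hknown w hw
      rw [hxi] at hadj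
      obtain ⟨p, hp, hbp⟩ := h1 (emb b) hadj
      rw [hbp, hpos0, sub_zero] at hw'
      rw [toE3_injective hw']; simpa using hp
    · intro k hk
      rw [hxi] at hk
      obtain ⟨p, hp, hkp⟩ := h1 k hk
      exact ⟨p, hp, by rw [hkp, hpos0, zero_add]⟩
    · intro v hv
      obtain ⟨k, hk, hkp⟩ := h2 v hv
      exact ⟨k, by rw [hxi]; exact hk, by rw [hkp, hpos0, zero_add]⟩
  · -- elsewhere: the completion table
    rw [if_neg hj0] at hcs
    obtain ⟨P0, Q, hP0, h1, h2⟩ := A.star (emb j) (A.ball_mono hl (hR.lvlE j hcur))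
    have hW : ∀ w ∈ s.known j, ∃ p ∈ P0, Q (toE3 p) = toE3 w := by
      intro w hw
      obtain ⟨b, hb, hadj, hw'⟩ := hknown w hw
      obtain ⟨p, hp, hbp⟩ := h1 (emb b) hadj
      exact ⟨p, hp, by rw [hw', hbp, _root_.add_sub_cancel_left]⟩
    obtain ⟨V, hV, hfwd, hbwd⟩ := completions_sound Q hP0 hW hcs
    have hunit : ∀ v ∈ V, V3.n2 v = NN2 := by
      intro v hv
      obtain ⟨p, hp, hpv⟩ := hbwd v hv
      rw [← norm_toE3_sq_eq_two_iff, ← hpv, LinearIsometry.norm_map, norm_toE3_sq_eq_two_iff]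
      exact n2_eq_of_mem_model hP0 hp
    refine ⟨V, ?_, hunit, ?_, ?_⟩
    · rw [List.mem_filter]
      refine ⟨hV, List.all_eq_true.2 fun w hw => ?_⟩
      obtain ⟨p, hp, hpw⟩ := hW w hw
      obtain ⟨v, hv, hpv⟩ := hfwd p hp
      rw [hpv] at hpw
      rw [← toE3_injective hpw]; simpa using hv
    · intro k hk
      obtain ⟨p, hp, hkp⟩ := h1 k hk
      obtain ⟨v, hv, hpv⟩ := hfwd p hp
      exact ⟨v, hv, by rw [hkp, hpv]⟩
    · intro v hv
      obtain ⟨p, hp, hpv⟩ := hbwd v hv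
      obtain ⟨k, hk, hkp⟩ := h2 p hp
      exact ⟨k, hk, by rw [hkp, hpv]⟩

/-- **Soundness of the expansion step**: some option of a realized state whose cursor site has
level `≤ 4` is realized. [folklore] -/
theorem options_sound {s : St} {emb : ℕ → Fin A.N} (hR : RealizedBy A s emb) (hcur : s.cur < s.size)
    (hl : s.lvl s.cur ≤ 4) {opts : List St} (ho : s.options TABLE = some opts) :
    ∃ s' ∈ opts, ∃ emb' : ℕ → Fin A.N, Nonempty (RealizedBy A s' emb') := by
  rw [options_eq, Option.map_eq_some_iff] at ho
  obtain ⟨cs, hcs, rfl⟩ := ho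
  obtain ⟨V, hVf, hVu, hV1, hV2⟩ := exists_candidate hR hcur hl hcs
  obtain ⟨s1, hs1, emb1, ⟨hR1⟩, hc1, hsz1, hl1, hkeep, -, hcov⟩ :=
    linkSlots_sound A V s.cur hVu V s emb hR rfl hcur hl hV1 hV2 (fun v hv => hv)
  have hV1' : ∀ k, A.G.Adj (emb1 s.cur) k → ∃ v ∈ V, A.pos k = A.pos (emb1 s.cur) + toE3 v := by
    rw [(hkeep s.cur hcur).2]; exact hV1
  have hcov' : ∀ v ∈ V, ∃ b ∈ s1.nbrs s.cur, s1.pos b = V3.add (s1.pos s.cur) v := by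
    rw [(hkeep s.cur hcur).1]; exact hcov
  obtain ⟨s2, hs2, hR2⟩ := finish_sound hR1 hc1.symm (by rw [hc1]; exact lt_of_lt_of_le hcur hsz1) (by rw [hl1]; exact hl)
    hV1' hcov'
  refine ⟨s2, ?_, emb1, hR2⟩
  rw [List.mem_flatMap]
  exact ⟨V, hVf, List.mem_filterMap.2 ⟨s1, hs1, hs2⟩⟩

end Options

end OneStacking


end Summit.AtomisticToContinuum.Crystallization.Theorems
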